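/-
Origin: expansion seat `literature-prover-pub-hodgecm-cf-hasseminkowski-g7-0`, handover #1(2) 2026-08-18T11:12:46Z (`HOME/pub-hodgecm-cf-hasseminkowski-g7/lean/CfHM7/OMeara661Low.lean`, md5 5024e4e8, 264 lines);
landed by the gen-7 packager in gate run 28 as `HodgeCM/Literature/OMeara661Low.lean` (import ^import CfHM7\.→import HodgeCM.Literature. ×1).
-/
/-
Copyright: pub-hodgecm formalisation cell (harness21, 2026). New file (not vendored).
Origin: CITED-FACT seat (4) `literature-prover-pub-hodgecm-cf-hasseminkowski-g7-0` (unit pub-hodgecm-cf-hasseminkowski-g7),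
2026-08-18; proposed place `HodgeCM/Literature/OMeara661Low.lean` (WIP module `CfHM7.OMeara661Low`).
-/
import Summits.HodgeConjecture.HodgeCM.Literature.OMeara661Algebra
import Literature.NumberTheory.QuadraticForms.GlobalSquareTheoremProofs
import Literature.NumberTheory.QuadraticForms.HasseNormTheoremHolds
import Literature.NumberTheory.Automorphic.AdeleBaseChange
import Literature.NumberTheory.Automorphic.QuaternionAlgebraEmbeddingProofs

/-!
# O'Meara 66:1 in dimensions `≤ 4` (steps 1)–4) of the printed proof)

The Hasse–Minkowski isotropy principle `HodgeCM.Literature.OMeara_66_1` (O'Meara, *Introduction to Quadratic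
Forms* (1963), §66 Thm 66:1 p. 187) for regular diagonal spaces `⟨c₁,…,cₙ⟩` over a number field `F`, in
dimensions `n ≤ 4`, following the printed proof (pp. 187–188, held e-text chunks p0191–p0193) step by step:

* `isotropic_of_le_one` — step 1): for `n ≤ 1` the local hypothesis at an archimedean spot is absurd.
* `isotropic_two` — step 2) "The binary case": `-c₁c₂` is a square at all finite spots, hence a square in `F`
  by the **Global Square Theorem 65:15** (cone: `Literature.NumberTheory.QuadraticForms.globalSquareTheorem_holds`).
* `isotropic_three` — step 3) "The ternary case": after scaling, `⟨c⟩ ≅ ⟨-α⟩ ⊥ ⟨1, -θ⟩`; local isotropy says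
  `α` is a local norm from `F(√θ)` at every spot, and the **Hasse Norm Theorem 65:23** (cone:
  `Literature.NumberTheory.Automorphic.hilbertSymbol_eq_one_of_forall_completions_holds`, the Hilbert-symbol form
  `(θ, α)_v = 1 ∀ v ⇒ (θ, α)_F = 1`) makes it a global norm.
* `isotropic_four` — step 4) "The quaternary case": if `dV = c₁c₂c₃c₄` is a square, every localization of
  the ternary sub-space `U = ⟨c₁,c₂,c₃⟩` is isotropic (42:12, `diagIsotropic_three_of_four_of_isSquare_disc` in
  each completion), so `U` is isotropic by step 3); in general pass to `E = F(√dV)` (Mathlib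
  `QuadraticAlgebra F dV 0`, a number field: cone `QuadraticAlgebra.numberField`), where `EV` is isotropic at
  every spot `𝔓` (it contains the `F_𝔭`-form, `F_𝔭 ⊆ E_𝔓`: cone `adicCompletionOfUnder`, `infiniteCompletionOfComap`)
  and has square discriminant, hence `EU` is isotropic over `E`; the two `F`-coordinates of an isotropic vector of
  `EU` descend to an isotropic vector of `V` over `F` (58:7, `diagIsotropic_four_of_ternary_descent`).

Everything is a theorem; inputs are the vendored harness cone (kernel-checked) and Mathlib.

## References
* O. T. O'Meara, *Introduction to Quadratic Forms*, Grundlehren 117, Springer 1963, §66 Thm 66:1 (pp. 186–188),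
  42:12, 58:7, 65:15, 65:23 [corpus:book:o-meara1963-introduction-quadratic-forms p0191–p0193].
-/

set_option autoImplicit false

noncomputable section

open NumberField IsDedekindDomain
open Literature.NumberTheory.QuadraticForms Literature.NumberTheory.Automorphic

namespace HodgeCM.Literature.OMeara661

variable {F : Type} [Field F] [NumberField F]

/-! ### Step 1): dimension `≤ 1` -/

/-- For `n ≤ 1` a regular diagonal space is anisotropic everywhere, so the local hypothesis of 66:1 at an
(always existing) archimedean spot already yields the conclusion. -/
theorem isotropic_of_le_one {n : ℕ} (hn : n ≤ 1) (c : Fin n → F) (hc : ∀ i, c i ≠ 0)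
    (hinf : ∀ v : InfinitePlace F, DiagIsotropic (fun i => algebraMap F v.Completion (c i))) :
    DiagIsotropic c := by
  obtain ⟨w⟩ := (inferInstance : Nonempty (InfinitePlace F))
  obtain ⟨x, hx0, hx⟩ := hinf w
  exfalso
  obtain ⟨j, hj⟩ : ∃ j, x j ≠ 0 := by
    by_contra hall
    push Not at hall
    exact hx0 (funext hall)
  haveI : Subsingleton (Fin n) := by
    rcases Nat.le_one_iff_eq_zero_or_eq_one.1 hn with rfl | rfl <;> infer_instance
  have hsum : ∑ i, algebraMap F w.Completion (c i) * x i ^ 2 =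
      algebraMap F w.Completion (c j) * x j ^ 2 := by
    rw [Finset.sum_eq_single j (fun i _ hij => absurd (Subsingleton.elim i j) hij) (by simp)]
  rw [hsum] at hx
  rcases mul_eq_zero.1 hx with h | h
  · exact (hc j) ((map_eq_zero _).1 h)
  · exact hj (pow_eq_zero_iff (n := 2) (by norm_num) |>.1 h)

/-! ### Step 2): the binary case — Global Square Theorem -/

/-- **66:1 for `n = 2`**: `-c₁c₂` is a square in every `F_v` (`v` finite), hence in `F` (65:15). -/
theorem isotropic_two (c : Fin 2 → F) (hc : ∀ i, c i ≠ 0)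
    (hfin : ∀ v : HeightOneSpectrum (𝓞 F),
      DiagIsotropic (fun i => algebraMap F (v.adicCompletion F) (c i))) :
    DiagIsotropic c := by
  rw [diagIsotropic_two_iff_isSquare (hc 0) (hc 1)]
  refine globalSquareTheorem_holds F _ (Filter.Eventually.of_forall fun v => ?_)
  have hcv : ∀ i, algebraMap F (v.adicCompletion F) (c i) ≠ 0 := fun i => (map_ne_zero _).2 (hc i)
  have h := (diagIsotropic_two_iff_isSquare (c := fun i => algebraMap F (v.adicCompletion F) (c i))
    (hcv 0) (hcv 1)).1 (hfin v)
  simpa [map_neg, map_mul] using h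

/-! ### Step 3): the ternary case — Hasse Norm Theorem -/

/-- **66:1 for `n = 3`**: with `α = -c₁/c₃`, `θ = -c₂/c₃` (so `⟨c⟩ ≅ c₃·⟨-α… ⟩`), isotropy of `⟨c⟩` over a
field is `(α, θ) = 1` (`diagIsotropic_three_iff_hilbertSymbol`); the local symbols are all `1`, hence so is the
global one by the Hasse Norm Theorem for `F(√α)/F` (65:23). -/
theorem isotropic_three (c : Fin 3 → F) (hc : ∀ i, c i ≠ 0)
    (hinf : ∀ v : InfinitePlace F, DiagIsotropic (fun i => algebraMap F v.Completion (c i)))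
    (hfin : ∀ v : HeightOneSpectrum (𝓞 F),
      DiagIsotropic (fun i => algebraMap F (v.adicCompletion F) (c i))) :
    DiagIsotropic c := by
  haveI : NeZero (2 : F) := ⟨two_ne_zero⟩
  set a : F := -(c 0 / c 2) with ha
  set b : F := -(c 1 / c 2) with hb
  have ha0 : a ≠ 0 := neg_ne_zero.2 (div_ne_zero (hc 0) (hc 2))
  have hb0 : b ≠ 0 := neg_ne_zero.2 (div_ne_zero (hc 1) (hc 2))
  rw [diagIsotropic_three_iff_hilbertSymbol (hc 0) (hc 1) (hc 2)]
  by_cases has : IsSquare a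
  · exact hilbertSymbol_eq_one_of_isSquare has ha0 b
  refine hilbertSymbol_eq_one_of_forall_completions_holds F a b has hb0 (fun v => ?_) (fun w => ?_)
  · haveI := neZero_two_adicCompletion F v
    have hcv : ∀ i, algebraMap F (v.adicCompletion F) (c i) ≠ 0 := fun i => (map_ne_zero _).2 (hc i)
    have h := (diagIsotropic_three_iff_hilbertSymbol
      (c := fun i => algebraMap F (v.adicCompletion F) (c i)) (hcv 0) (hcv 1) (hcv 2)).1 (hfin v)
    simpa [ha, hb, map_neg, map_div₀] using h
  · haveI : CharZero w.Completion := charZero_of_injective_algebraMap (algebraMap F _).injective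
    haveI : NeZero (2 : w.Completion) := ⟨two_ne_zero⟩
    have hcw : ∀ i, algebraMap F w.Completion (c i) ≠ 0 := fun i => (map_ne_zero _).2 (hc i)
    have h := (diagIsotropic_three_iff_hilbertSymbol
      (c := fun i => algebraMap F w.Completion (c i)) (hcw 0) (hcw 1) (hcw 2)).1 (hinf w)
    simpa [ha, hb, map_neg, map_div₀] using h

/-! ### Step 4): the quaternary case -/

/-- Step 4), first half: if `dV = c₁c₂c₃c₄` is a square in `F` and `V = ⟨c⟩` is isotropic at every spot, then
the ternary sub-space `U = ⟨c₁,c₂,c₃⟩` is isotropic at every spot (42:12 in each completion), hence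
isotropic (step 3)). -/
theorem isotropic_three_of_four_of_sq_disc (c : Fin 4 → F) (hc : ∀ i, c i ≠ 0) {s : F}
    (hs : c 0 * c 1 * c 2 * c 3 = s ^ 2)
    (hinf : ∀ v : InfinitePlace F, DiagIsotropic (fun i => algebraMap F v.Completion (c i)))
    (hfin : ∀ v : HeightOneSpectrum (𝓞 F),
      DiagIsotropic (fun i => algebraMap F (v.adicCompletion F) (c i))) :
    DiagIsotropic (fun i : Fin 3 => c i.castSucc) := by
  refine isotropic_three _ (fun i => hc _) (fun w => ?_) (fun v => ?_)
  · have hcw : ∀ i, algebraMap F w.Completion (c i) ≠ 0 := fun i => (map_ne_zero _).2 (hc i)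
    have hs' : algebraMap F w.Completion (c 0) * algebraMap F _ (c 1) * algebraMap F _ (c 2) *
        algebraMap F _ (c 3) = (algebraMap F _ s) ^ 2 := by
      rw [← map_mul, ← map_mul, ← map_mul, hs, map_pow]
    exact diagIsotropic_three_of_four_of_isSquare_disc (c := fun i => algebraMap F w.Completion (c i))
      hcw hs' (hinf w)
  · have hcv : ∀ i, algebraMap F (v.adicCompletion F) (c i) ≠ 0 := fun i => (map_ne_zero _).2 (hc i)
    have hs' : algebraMap F (v.adicCompletion F) (c 0) * algebraMap F _ (c 1) * algebraMap F _ (c 2) *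
        algebraMap F _ (c 3) = (algebraMap F _ s) ^ 2 := by
      rw [← map_mul, ← map_mul, ← map_mul, hs, map_pow]
    exact diagIsotropic_three_of_four_of_isSquare_disc
      (c := fun i => algebraMap F (v.adicCompletion F) (c i)) hcv hs' (hfin v)

/-- The embedding `F_v → E_w` of completions at finite places (`w ∣ v`, cone `adicCompletionOfUnder`) is
compatible with `F → E` on the images of `F`. -/
theorem adicCompletionOfUnder_algebraMap (E : Type) [Field E] [NumberField E] [Algebra F E]
    (w : HeightOneSpectrum (𝓞 E)) (x : F) :
    adicCompletionOfUnder (𝓞 F) F E w (algebraMap F ((w.under (𝓞 F)).adicCompletion F) x) =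
      algebraMap E (w.adicCompletion E) (algebraMap F E x) := by
  have h1 : algebraMap F ((w.under (𝓞 F)).adicCompletion F) x =
      (x : (w.under (𝓞 F)).adicCompletion F) := rfl
  have h2 : algebraMap E (w.adicCompletion E) (algebraMap F E x) =
      ((algebraMap F E x : E) : w.adicCompletion E) := rfl
  rw [h1, h2]
  exact adicCompletionOfUnder_coe F E w x

omit [NumberField F] in
/-- The embedding `F_v → E_w` of completions at infinite places (`v = w ∘ (F → E)`, cone
`infiniteCompletionOfComap`) is compatible with `F → E`. -/
theorem infiniteCompletionOfComap_algebraMap (E : Type) [Field E] [Algebra F E]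
    (w : InfinitePlace E) (x : F) :
    infiniteCompletionOfComap F E w (algebraMap F (w.comap (algebraMap F E)).Completion x) =
      algebraMap E w.Completion (algebraMap F E x) := by
  have h1 : algebraMap F (w.comap (algebraMap F E)).Completion x =
      ((WithAbs.toAbs (w.comap (algebraMap F E)).1 x : WithAbs (w.comap (algebraMap F E)).1) :
        (w.comap (algebraMap F E)).Completion) := rfl
  have h2 : algebraMap E w.Completion (algebraMap F E x) =
      ((WithAbs.toAbs w.1 (algebraMap F E x) : WithAbs w.1) : w.Completion) := rfl
  rw [h1, h2]
  exact infiniteCompletionOfComap_coe F E w x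

/-- Local isotropy is inherited by the base change `EV` of `V = ⟨c⟩` to a finite extension `E/F`: every spot
`𝔓` of `E` lies over a spot `𝔭` of `F` and `F_𝔭 V ⊆ (EV)_𝔓` (O'Meara, proof of 66:1 step 4: "this latter
space is easily seen to be isotropic since `V_𝔭` is isotropic"). Finite places. -/
theorem diagIsotropic_baseChange_finite (E : Type) [Field E] [NumberField E] [Algebra F E] {n : ℕ}
    (c : Fin n → F)
    (hfin : ∀ v : HeightOneSpectrum (𝓞 F),
      DiagIsotropic (fun i => algebraMap F (v.adicCompletion F) (c i)))
    (w : HeightOneSpectrum (𝓞 E)) :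
    DiagIsotropic (fun i => algebraMap E (w.adicCompletion E) (algebraMap F E (c i))) := by
  have h := (hfin (w.under (𝓞 F))).map (adicCompletionOfUnder (𝓞 F) F E w)
    (adicCompletionOfUnder (𝓞 F) F E w).injective
  simpa only [adicCompletionOfUnder_algebraMap] using h

omit [NumberField F] in
/-- Local isotropy is inherited by base change: infinite places. -/
theorem diagIsotropic_baseChange_infinite (E : Type) [Field E] [NumberField E] [Algebra F E] {n : ℕ}
    (c : Fin n → F)
    (hinf : ∀ v : InfinitePlace F, DiagIsotropic (fun i => algebraMap F v.Completion (c i)))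
    (w : InfinitePlace E) :
    DiagIsotropic (fun i => algebraMap E w.Completion (algebraMap F E (c i))) := by
  have h := (hinf (w.comap (algebraMap F E))).map (infiniteCompletionOfComap F E w)
    (infiniteCompletionOfComap F E w).injective
  simpa only [infiniteCompletionOfComap_algebraMap] using h

/-- Step 4), second half, over `E = F(√D)` realised as Mathlib's `QuadraticAlgebra F D 0` (`ω² = D`): for
`D = c₁c₂c₃c₄` not a square in `F`, `E` is a number field, `EV` is isotropic at all spots of `E` and has square
discriminant, so `E⟨c₁,c₂,c₃⟩` is isotropic (first half over `E`), and the two `F`-coordinates `x, y ∈ F³` of an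
isotropic vector `x + ω y` satisfy `B(x,y) = 0`, `T(x) = -D·T(y)`, whence `V` is isotropic over `F` (58:7,
`diagIsotropic_four_of_ternary_descent`). -/
theorem isotropic_four_of_not_isSquare (c : Fin 4 → F) (hc : ∀ i, c i ≠ 0) {D : F}
    (hD : c 0 * c 1 * c 2 * c 3 = D) (hsq : ¬ IsSquare D)
    (hinf : ∀ v : InfinitePlace F, DiagIsotropic (fun i => algebraMap F v.Completion (c i)))
    (hfin : ∀ v : HeightOneSpectrum (𝓞 F),
      DiagIsotropic (fun i => algebraMap F (v.adicCompletion F) (c i))) :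
    DiagIsotropic c := by
  haveI := fact_sq_ne_of_not_isSquare F D hsq
  haveI : NumberField (QuadraticAlgebra F D 0) := QuadraticAlgebra.numberField F D
  have hc' : ∀ i, algebraMap F (QuadraticAlgebra F D 0) (c i) ≠ 0 := fun i => (map_ne_zero _).2 (hc i)
  have hω : algebraMap F (QuadraticAlgebra F D 0) (c 0) * algebraMap F _ (c 1) * algebraMap F _ (c 2) *
      algebraMap F _ (c 3) = (QuadraticAlgebra.omega : QuadraticAlgebra F D 0) ^ 2 := by
    rw [← map_mul, ← map_mul, ← map_mul, hD, sq, QuadraticAlgebra.omega_mul_omega_eq_algebraMap]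
  have hT := isotropic_three_of_four_of_sq_disc (F := QuadraticAlgebra F D 0)
    (fun i => algebraMap F (QuadraticAlgebra F D 0) (c i)) hc' hω
    (diagIsotropic_baseChange_infinite (QuadraticAlgebra F D 0) c hinf)
    (diagIsotropic_baseChange_finite (QuadraticAlgebra F D 0) c hfin)
  obtain ⟨z, hz0, hz⟩ := hT
  rw [Fin.sum_univ_three] at hz
  change algebraMap F (QuadraticAlgebra F D 0) (c 0) * z 0 ^ 2 +
    algebraMap F (QuadraticAlgebra F D 0) (c 1) * z 1 ^ 2 +
    algebraMap F (QuadraticAlgebra F D 0) (c 2) * z 2 ^ 2 = 0 at hz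
  have key : ∀ (a : F) (w : QuadraticAlgebra F D 0), algebraMap F (QuadraticAlgebra F D 0) a * w ^ 2 =
      (⟨a * (w.re ^ 2 + D * w.im ^ 2), a * (2 * w.re * w.im)⟩ : QuadraticAlgebra F D 0) := by
    intro a w
    ext <;> simp only [sq, QuadraticAlgebra.re_mul, QuadraticAlgebra.im_mul, QuadraticAlgebra.algebraMap_re,
      QuadraticAlgebra.algebraMap_im] <;> ring
  rw [key, key, key] at hz
  obtain ⟨hre, him⟩ := QuadraticAlgebra.ext_iff.1 hz
  simp only [QuadraticAlgebra.re_add, QuadraticAlgebra.im_add, QuadraticAlgebra.re_zero,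
    QuadraticAlgebra.im_zero] at hre him
  refine diagIsotropic_four_of_ternary_descent hc (z 0).re (z 1).re (z 2).re (z 0).im (z 1).im (z 2).im
    ?_ ?_ ?_
  · rintro ⟨h0, h1, h2, h3, h4, h5⟩
    apply hz0
    funext i
    fin_cases i
    · exact QuadraticAlgebra.ext h0 h3
    · exact QuadraticAlgebra.ext h1 h4
    · exact QuadraticAlgebra.ext h2 h5
  · have h2 : (2 : F) ≠ 0 := two_ne_zero
    have : (2 : F) * (c 0 * (z 0).re * (z 0).im + c 1 * (z 1).re * (z 1).im + c 2 * (z 2).re * (z 2).im) = 0 := by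
      linear_combination him
    exact (mul_eq_zero.1 this).resolve_left h2
  · linear_combination hre + (c 0 * (z 0).im ^ 2 + c 1 * (z 1).im ^ 2 + c 2 * (z 2).im ^ 2) * hD

/-- **66:1 for `n = 4`** (O'Meara step 4)): square discriminant by 42:12 + step 3); otherwise over
`E = F(√dV)` the discriminant becomes a square, `EV` is isotropic at all spots, so `E⟨c₁,c₂,c₃⟩` is
isotropic, and an isotropic vector `x + √dV·y` (`x, y ∈ F³`) descends (58:7). -/
theorem isotropic_four (c : Fin 4 → F) (hc : ∀ i, c i ≠ 0)
    (hinf : ∀ v : InfinitePlace F, DiagIsotropic (fun i => algebraMap F v.Completion (c i)))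
    (hfin : ∀ v : HeightOneSpectrum (𝓞 F),
      DiagIsotropic (fun i => algebraMap F (v.adicCompletion F) (c i))) :
    DiagIsotropic c := by
  by_cases hsq : IsSquare (c 0 * c 1 * c 2 * c 3)
  · obtain ⟨s, hs⟩ := hsq
    have hT := isotropic_three_of_four_of_sq_disc c hc (s := s) (by rw [hs, sq]) hinf hfin
    exact DiagIsotropic.of_comp_injective Fin.castSucc (Fin.castSucc_injective _) hT
  · exact isotropic_four_of_not_isSquare c hc rfl hsq hinf hfin

end HodgeCM.Literature.OMeara661

end
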